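import Mathlib.SetTheory.Cardinal.ENat
import Mathlib.LinearAlgebra.Matrix.Rank
import Literature.NumberTheory.Transcendental.GammaFields
import Literature.NumberTheory.Transcendental.EclPregeometry
import Literature.NumberTheory.Transcendental.EclPregeometryProofs
import Literature.NumberTheory.Transcendental.EclClosureOperatorProofs
import Literature.NumberTheory.Transcendental.KirbyEDerivations
import Literature.NumberTheory.Transcendental.KirbyWeakSchanuelProofs
import Literature.NumberTheory.Transcendental.AxSchanuel
import Literature.NumberTheory.Transcendental.KirbyWeakSchanuelAx
import HarnessLib

/-!
# Γ-fields and Kirby's `ecl`-pregeometry: `ecl`-closed subfields are Γ-closed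

Sibling of `GammaFields.lean` (Bays–Kirby predimension `δ` inside an exponential field `F`).
Bays–Kirby 2018, Remark 10.10 ("`ecl`-closed = `Γcl`-closed [EAEF]") rests on J. Kirby,
*Exponential algebraicity in exponential fields*, Bull. LMS 42 (2010), Thm 1.2:

> Suppose `C ⊆ F` is `ecl^F`-closed. Let `x₁, …, xₙ ∈ F`. Then
> `td(x̄, exp(x̄)/C) - ldim_ℚ(x̄/C) ≥ dim^F(x̄/C)`.

The tree derives the case "`≥ 0`" twice: `Literature.NumberTheory.Transcendental.Kirby2010_weakSchanuel_of`
(`KirbyWeakSchanuelProofs.lean`) from the two named facts on which the printed proof rests — Ax's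
theorem (`Literature.NumberTheory.Transcendental.ax_schanuel`, Ax 1971 Thm. 3 = Kirby 2010 Thm. 5.1, now proved in
the tree: `Literature.NumberTheory.Transcendental.ax_schanuel_holds`, `RosenlichtProp4Residues.lean`) and Kirby's
Prop. 7.1 `cl ⊆ ecl` (`Literature.NumberTheory.Transcendental.Kirby2010_dcl_subset_ecl`) — and `Literature.NumberTheory.Transcendental.le_relTrdeg_of_isEclClosed`
(`KirbyWeakSchanuelAx.lean`) from Ax's theorem *alone*, running Kirby's argument inside the
finitely generated field `ℚ(C)(x̄, e^{x̄})` via the Khovanskii dichotomy. Here we derive the case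
"`dim ≥ 1`" of Thm 1.2 — if `x̄` is `ℚ`-linearly independent modulo `C` and some `xᵢ ∉ C` then
`n + 1 ≤ td(x̄, exp x̄/C)` — in both ways: `succ_le_relTrdeg_of_dcl_subset` (from `ax_schanuel`
and `dcl C ⊆ C`: the extra derivation `∂` with `∂xᵢ ≠ 0` contributes `1` to the rank term of Ax's
theorem) and **`Literature.NumberTheory.Transcendental.succ_le_relTrdeg_of_isEclClosed`** (from `ax_schanuel` alone, for `ecl`-closed
`C`: the argument of `le_relTrdeg_of_isEclClosed` keeping the rank term of Ax's theorem, which is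
`1` for the non-zero E-derivation produced by the Khovanskii dichotomy); universe `0`, as
`ax_schanuel` is stated there. Then we translate it into the language of `GammaFields.lean`:

* `ecl C` as the `ℚ`-subspace `Submodule.span ℚ (ecl C)` of `F` (`coe_span_ecl`: the span is
  `ecl C` itself; it is an `exp`-closed subfield containing `ker exp` and all logarithms of its
  elements: `exp_mem_span_ecl`, `mem_span_ecl_of_exp_mem`, `expKernel_subset_ecl`). No new
  definitions are introduced in this file.
* the comparison of Kirby's `td(x̄, exp x̄/C)`, `ldim_ℚ(x̄/C)` (`Literature.NumberTheory.Transcendental.relTrdeg`, `Literature.NumberTheory.Transcendental.relLinDim` of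
  `EclPregeometry.lean`, `Algebra.trdeg`-based) with the matroidal `GammaField.td`,
  `GammaField.ldim`: `relLinDim_eq_ldim` and `toENat_relTrdeg_le_relRank` (an algebraically
  independent family over `ℚ(C)` inside `ℚ(C)(S)` is independent in the contraction of the
  algebraic matroid by `C`, `GammaField.contract_indep_of_algebraicIndepOn`), and conversely
  (`relRank_le_toENat_trdeg_adjoin`, via `AlgebraicIndependent.extendScalars` along the algebraic
  extension `ℚ(B) ≤ ℚ(C)`, `B` a transcendence basis), whence the equalities
  `toENat_relTrdeg_eq_relRank` and `td_span_ecl_span_eq_relTrdeg :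
  td (span (ecl C)) (span x̄) = relTrdeg (ecl C) x̄`, answering the request (reviews of
  `RelRank.lean` and `GammaFields.lean`) to relate the two predimension vocabularies;
* **`Literature.NumberTheory.Transcendental.GammaField.isGammaClosed_span_ecl`**: granted `ax_schanuel` (only), every `ecl`-closed
  `C` is Γ-closed in `F` in the sense of Bays–Kirby Def. 4.9 (`GammaField.IsGammaClosed`): a
  proper finitely generated extension `C + ℚx̄` has `δ(x̄/C) ≥ 1`. In particular `ecl`-closed
  sets are strong (`δ ≥ 0`), which is Bays–Kirby's use of Kirby's theorem in §10–11
  (`isStrong_span_ecl`).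

All statements are proved (from the named fact `ax_schanuel` where indicated, itself proved in
`RosenlichtProp4Residues.lean`, which this file does not import).

## References

* J. Kirby, *Exponential algebraicity in exponential fields*, Bull. LMS 42 (2010) 879–890,
  arXiv:0810.4285: Thm 1.2, Lemma 3.3, Lemma 4.8, Thm 5.1 (Ax), Cor. 5.2, Prop. 7.1.
* J. Ax, *On Schanuel's conjectures*, Ann. of Math. 93 (1971) 252–268, Thm. 3.
* M. Bays, J. Kirby, *Pseudo-exponential maps, variants, and quasiminimality*, Algebra & Number
  Theory 12 (2018), Def. 4.9, Remark 10.10.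
-/

noncomputable section

open Set Cardinal

namespace Literature.NumberTheory.Transcendental

namespace GammaField

open Literature.ModelTheory.ExponentialFields.ExponentialRing

/-! ### `ecl C` as a `ℚ`-subspace -/

section EclSubmodule

variable {F : Type*} [Field F] [CharZero F] [Literature.ModelTheory.ExponentialFields.ExponentialRing F]

/-- `ecl C` is (the carrier of) a `ℚ`-subspace of `F`: it is a subfield
(`Literature.NumberTheory.Transcendental.Khovanskii.eclSubfield`) of a field of characteristic zero, so its `ℚ`-span is itself. We
work with `Submodule.span ℚ (ecl C)` throughout (no new definition). [cite: Kirby2010, Lemma 3.3] -/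
@[simp] theorem coe_span_ecl (C : Set F) : (Submodule.span ℚ (ecl C) : Set F) = ecl C := by
  let S : Submodule ℚ F :=
    { carrier := ecl C
      add_mem' := Khovanskii.add_mem_ecl
      zero_mem' := Khovanskii.zero_mem_ecl C
      smul_mem' := fun q x hx => by
        rw [Rat.smul_def]
        exact Khovanskii.mul_mem_ecl (SubfieldClass.ratCast_mem (Khovanskii.eclSubfield C) q) hx }
  change (Submodule.span ℚ (S : Set F) : Set F) = (S : Set F)
  rw [Submodule.span_eq]

/-- Membership in `span ℚ (ecl C)` is membership in `ecl C`. [cite: Kirby2010, Lemma 3.3] -/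
@[simp] theorem mem_span_ecl_iff {C : Set F} {a : F} :
    a ∈ Submodule.span ℚ (ecl C) ↔ a ∈ ecl C := by
  rw [← SetLike.mem_coe, coe_span_ecl]

/-- `ecl C` is closed under `exp`. [cite: Kirby2010, Lemma 3.3] -/
theorem exp_mem_span_ecl {C : Set F} {a : F} (ha : a ∈ Submodule.span ℚ (ecl C)) :
    exp a ∈ Submodule.span ℚ (ecl C) := by
  rw [mem_span_ecl_iff] at ha ⊢
  exact Khovanskii.exp_mem_ecl ha

omit [CharZero F] in
/-- `ecl C` contains all logarithms of its elements: if `exp a ∈ ecl C` then `a ∈ ecl C`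
(`a` solves the one-unknown Khovanskii system `Y - exp a = 0`, `∂/∂x = Y ≠ 0`, over `ecl C`, and
`ecl (ecl C) = ecl C`). [cite: Kirby2010, Lemma 3.3] -/
theorem mem_ecl_of_exp_mem {C : Set F} {a : F} (ha : exp a ∈ ecl C) : a ∈ ecl C := by
  classical
  rw [← Khovanskii.ecl_ecl C, Khovanskii.mem_ecl_iff]
  refine ⟨Unit, inferInstance, inferInstance, fun _ => a,
    fun _ => MvPolynomial.X (Sum.inr ()) - MvPolynomial.C (exp a), ?_, (), rfl⟩
  refine Khovanskii.IsSol.single a _ ?_ ?_ ?_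
  · exact sub_mem (Khovanskii.X_mem_polyOver _ _)
      (Khovanskii.C_mem_polyOver (Subring.subset_closure ha))
  · simp
  · simp [Khovanskii.ePD, MvPolynomial.pderiv_X, (isUnit_exp a).ne_zero]

/-- Logarithms of elements of `span ℚ (ecl C)` lie in it. [cite: Kirby2010, Lemma 3.3] -/
theorem mem_span_ecl_of_exp_mem {C : Set F} {a : F} (ha : exp a ∈ Submodule.span ℚ (ecl C)) :
    a ∈ Submodule.span ℚ (ecl C) := by
  rw [mem_span_ecl_iff] at ha ⊢
  exact mem_ecl_of_exp_mem ha

omit [CharZero F] in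
/-- The kernel of `exp` lies in every `ecl C` (as `exp a = 1 ∈ ecl C`).
[cite: Kirby2010, Lemma 3.3] -/
theorem expKernel_subset_ecl (C : Set F) : (expKernel F : Set F) ⊆ ecl C := by
  intro a ha
  refine mem_ecl_of_exp_mem ?_
  rw [(mem_expKernel_iff a).1 ha]
  exact Khovanskii.one_mem_ecl C

/-- The generators `Λ ∪ exp Λ` of the Γ-subfield of `Λ = ecl C` are just `ecl C`.
[cite: Kirby2010, Lemma 3.3] -/
theorem gens_span_ecl (C : Set F) : gens (Submodule.span ℚ (ecl C)) = ecl C := by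
  refine Subset.antisymm ?_ (fun a ha => subset_gens (Submodule.span ℚ (ecl C)) (by
    rw [coe_span_ecl]; exact ha))
  rintro a (ha | ⟨b, hb, rfl⟩)
  · rwa [coe_span_ecl] at ha
  · rw [coe_span_ecl] at hb
    exact Khovanskii.exp_mem_ecl hb

end EclSubmodule

/-! ### Comparison with Kirby's `td(x̄, exp x̄/C)` and `ldim_ℚ(x̄/C)` -/

section Bridge

open Matroid

variable {F : Type*} [Field F] [CharZero F] [Literature.ModelTheory.ExponentialFields.ExponentialRing F]

omit [Literature.ModelTheory.ExponentialFields.ExponentialRing F] in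
/-- Kirby's `ldim_ℚ(x̄/C)` (`Literature.NumberTheory.Transcendental.relLinDim`) is `GammaField.ldim` of `span x̄` over `span C`.
[folklore] -/
theorem relLinDim_eq_ldim {n : ℕ} (C : Set F) (x : Fin n → F) :
    relLinDim C x = ldim (Submodule.span ℚ C) (Submodule.span ℚ (range x)) := by
  rw [relLinDim, ldim, Submodule.map_span, ← range_comp]

omit [Literature.ModelTheory.ExponentialFields.ExponentialRing F] in
/-- `acl s` as an intermediate field of `F/ℚ`. [folklore] -/
theorem exists_intermediateField_eq_acl (s : Set F) :
    ∃ E : IntermediateField ℚ F, (E : Set F) = acl s := by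
  refine ⟨
    { carrier := acl s
      mul_mem' := mul_mem_acl
      one_mem' := one_mem_acl s
      add_mem' := add_mem_acl
      zero_mem' := zero_mem_acl s
      algebraMap_mem' := fun q => algebraMap_mem_acl q
      inv_mem' := fun _ => inv_mem_acl }, rfl⟩

omit [Literature.ModelTheory.ExponentialFields.ExponentialRing F] in
/-- `acl (ℚ(s)) = acl s`. [folklore] -/
theorem acl_adjoin (s : Set F) :
    acl ((IntermediateField.adjoin ℚ s : IntermediateField ℚ F) : Set F) = acl s :=
  Subset.antisymm (acl_subset_acl_of_subset (adjoin_subset_acl s))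
    (acl_mono (IntermediateField.subset_adjoin ℚ s))

omit [Literature.ModelTheory.ExponentialFields.ExponentialRing F] in
/-- Elements algebraically independent over a subfield `L` lie outside `L`. [folklore] -/
theorem disjoint_of_algebraicIndepOn (L : IntermediateField ℚ F) {I : Set F}
    (hI : AlgebraicIndepOn L id I) : Disjoint I (L : Set F) := by
  rw [Set.disjoint_left]
  intro a haI haL
  have ht : Transcendental L (id (⟨a, haI⟩ : I) : F) := hI.transcendental ⟨a, haI⟩
  exact ht (isAlgebraic_algebraMap (⟨a, haL⟩ : L))

omit [Literature.ModelTheory.ExponentialFields.ExponentialRing F] in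
/-- **Algebraic independence over a subfield is independence in the contraction.** If
`L ≤ F` is a subfield and `I ⊆ F` is algebraically independent over `L`, then `I` is independent
in the contraction of the algebraic matroid of `F/ℚ` by `L`: for a transcendence basis `B` of
`L/ℚ` (a basis of `L` in the matroid), `I ∪ B` is algebraically independent over `ℚ`
(`AlgebraicIndependent.sumElim_iff` after restricting scalars from `L` to `ℚ[B]`).
[folklore] -/
theorem contract_indep_of_algebraicIndepOn (L : IntermediateField ℚ F) {I : Set F}
    (hI : AlgebraicIndepOn L id I) : ((algMatroid F) ／ (L : Set F)).Indep I := by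
  classical
  set M := algMatroid F
  obtain ⟨B, hB⟩ := M.exists_isBasis (L : Set F)
  have hBL : B ⊆ (L : Set F) := hB.subset
  have hBind : AlgebraicIndepOn ℚ id B := AlgebraicIndependent.matroid_indep_iff.1 hB.indep
  have hdisj : Disjoint I (L : Set F) := disjoint_of_algebraicIndepOn L hI
  -- restrict scalars from `L` to `ℚ[B]`
  set R := Algebra.adjoin ℚ (range ((↑) : B → F)) with hR
  have hRL : R ≤ L.toSubalgebra := by
    rw [hR, Subtype.range_coe]
    exact Algebra.adjoin_le hBL
  letI : Algebra R L := (Subalgebra.inclusion hRL).toRingHom.toAlgebra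
  haveI : IsScalarTower R L F := IsScalarTower.of_algebraMap_eq fun _ => rfl
  have hinj : Function.Injective (algebraMap R L) := Subalgebra.inclusion_injective hRL
  have hI' : AlgebraicIndependent R ((↑) : I → F) := hI.restrictScalars hinj
  have hsum : AlgebraicIndependent ℚ (Sum.elim ((↑) : I → F) ((↑) : B → F)) :=
    AlgebraicIndependent.sumElim_iff.2 ⟨hBind, hI'⟩
  have hunion : M.Indep (I ∪ B) := by
    have := hsum.to_subtype_range
    rw [Sum.elim_range, Subtype.range_coe, Subtype.range_coe] at this
    exact this
  rw [hB.isBasis'.contract_indep_iff]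
  exact ⟨hunion, disjoint_comm.1 hdisj⟩

omit [Literature.ModelTheory.ExponentialFields.ExponentialRing F] in
/-- **`Algebra.trdeg` versus relative rank in the algebraic matroid.** For a subfield `L ≤ F` and
`S ⊆ F`, the transcendence degree of `L(S)` over `L` is at most the relative rank of `S` over `L`
in the algebraic matroid of `F/ℚ` (compared in `ℕ∞`): every `L`-algebraically independent subset
of `L(S)` is independent in the contraction by `L` and lies in the closure of `S ∪ L`.
(Both sides are in fact the size of a transcendence basis of `L(S)/L`; only `≤` is needed
below.) [folklore] -/
theorem toENat_trdeg_adjoin_le_relRank (L : IntermediateField ℚ F) (S : Set F) :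
    toENat (Algebra.trdeg L (IntermediateField.adjoin L S)) ≤
      (algMatroid F).relRank (L : Set F) S := by
  classical
  set M := algMatroid F
  set A : IntermediateField L F := IntermediateField.adjoin L S with hA
  rcases eq_or_ne (M.relRank (L : Set F) S) ⊤ with htop | hfin
  · rw [htop]; exact le_top
  obtain ⟨k, hk⟩ := ENat.ne_top_iff_exists.1 hfin
  rw [← hk]
  -- `L(S) ⊆ acl (S ∪ L)`
  have hAcl : ((A.restrictScalars ℚ : IntermediateField ℚ F) : Set F) ⊆
      M.closure (S ∪ (L : Set F)) := by
    change (A : Set F) ⊆ acl (S ∪ (L : Set F))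
    obtain ⟨E, hE⟩ := exists_intermediateField_eq_acl (F := F) (S ∪ (L : Set F))
    intro a ha
    have ha' : a ∈ A.toSubfield := ha
    rw [hA, IntermediateField.adjoin_toSubfield] at ha'
    have hsub : Set.range (algebraMap L F) ∪ S ⊆ (E.toSubfield : Set F) := by
      rintro b (⟨c, rfl⟩ | hb)
      · show algebraMap L F c ∈ (E : Set F)
        rw [hE]; exact subset_acl _ (Or.inr c.2)
      · show b ∈ (E : Set F)
        rw [hE]; exact subset_acl _ (Or.inl hb)
    have := (Subfield.closure_le (t := E.toSubfield)).2 hsub ha'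
    rw [← hE]; exact this
  have key : ∀ s : {s : Set A // AlgebraicIndepOn L _root_.id s}, #s.1 ≤ (k : Cardinal) := by
    rintro ⟨s, hs⟩
    set I : Set F := ((↑) : A → F) '' s with hIdef
    have hI : AlgebraicIndepOn L id I := by
      have h1 : AlgebraicIndependent L (A.val ∘ ((↑) : s → A)) :=
        hs.map' (f := A.val) (RingHom.injective _)
      have h2 := h1.to_subtype_range
      have hr : range (A.val ∘ ((↑) : s → A)) = I := by
        rw [range_comp, Subtype.range_coe]; rfl
      rw [hr] at h2
      exact h2
    have hind : (M ／ (L : Set F)).Indep I := contract_indep_of_algebraicIndepOn L hI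
    have hIS : I ⊆ M.closure (S ∪ (L : Set F)) := by
      intro b hb
      obtain ⟨a, _, rfl⟩ := hb
      exact hAcl a.2
    have h1 : M.relRank (L : Set F) I ≤ k := by
      rw [hk]; exact M.relRank_le_of_subset_closure _ hIS
    have h2 : M.relRank (L : Set F) I = I.encard := hind.eRk_eq_encard
    have h4 : toENat #I ≤ k := by rw [Set.toENat_cardinalMk, ← h2]; exact h1
    have h5 : #I < ℵ₀ := by
      rw [← Cardinal.toENat_ne_top]
      exact ne_top_of_le_ne_top (ENat.coe_ne_top k) h4
    obtain ⟨m, hm⟩ := Cardinal.lt_aleph0.1 h5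
    have h6 : m ≤ k := by
      rw [hm, map_natCast] at h4; exact_mod_cast h4
    calc #s = #I := (Cardinal.mk_image_eq Subtype.val_injective).symm
      _ = m := hm
      _ ≤ k := by exact_mod_cast h6
  have htr : Algebra.trdeg L A ≤ (k : Cardinal) := ciSup_le' key
  calc toENat (Algebra.trdeg L A) ≤ toENat (k : Cardinal) := OrderHomClass.mono _ htr
    _ = k := map_natCast _ k

/-- **`Literature.NumberTheory.Transcendental.relTrdeg` versus `GammaField.td`.** Kirby's `td(x̄, exp x̄/C)` (`Algebra.trdeg` of
`ℚ(C)(x̄, exp x̄)` over `ℚ(C)`) is at most the relative rank of `x̄ ∪ exp x̄` over `C` in the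
algebraic matroid of `F/ℚ`, which for a `ℚ`-subspace `Λ` with `gens Λ`-closure equal to
`acl C` is `GammaField.td` (see `td_span_ecl_span_eq`). Answers the request (review of
`RelRank.lean`) to relate `Matroid.relRank` of the algebraic matroid to `Literature.NumberTheory.Transcendental.relTrdeg`.
[folklore] -/
theorem toENat_relTrdeg_le_relRank {n : ℕ} (C : Set F) (x : Fin n → F) :
    toENat (relTrdeg C x) ≤ (algMatroid F).relRank C (range x ∪ range (exp ∘ x)) := by
  rw [relTrdeg, (algMatroid F).relRank_congr_closure_left (range x ∪ range (exp ∘ x))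
    (show (algMatroid F).closure C =
      (algMatroid F).closure ((IntermediateField.adjoin ℚ C : IntermediateField ℚ F) : Set F)
      from (acl_adjoin C).symm)]
  exact toENat_trdeg_adjoin_le_relRank _ _

/-- For `Λ = ecl C` (so `gens Λ = ecl C`) and a tuple `x̄`, `td Λ (span x̄)` is the relative rank
of `x̄ ∪ exp x̄` over `ecl C`. [folklore] -/
theorem td_span_ecl_span_eq {n : ℕ} (C : Set F) (x : Fin n → F) :
    td (Submodule.span ℚ (ecl C)) (Submodule.span ℚ (range x)) =
      (algMatroid F).relRank (ecl C) (range x ∪ range (exp ∘ x)) := by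
  refine le_antisymm ?_ ?_
  · have h := td_span_le_relRank (Submodule.span ℚ (ecl C)) (range x)
    rwa [gens_span_ecl, ← range_comp] at h
  · rw [td_def, gens_span_ecl]
    refine (algMatroid F).relRank_mono_right _ ?_
    rintro a (⟨i, rfl⟩ | ⟨i, rfl⟩)
    · exact mem_gens_of_mem (Submodule.subset_span (mem_range_self i))
    · exact exp_mem_gens (Submodule.subset_span (mem_range_self i))

end Bridge

/-! ### Kirby 2010, Thm 1.2 with the dimension term `≥ 1`, from Ax's theorem -/

section KirbyDim

variable {F : Type} [Field F] [CharZero F] [Literature.ModelTheory.ExponentialFields.ExponentialRing F]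

/-- **Kirby 2010, Thm 1.2 (case `dim ≥ 1`) from Ax's theorem.** If `dcl C ⊆ C`,
`x : Fin n → F` is `ℚ`-linearly independent modulo `⟨C⟩_ℚ` and some `xᵢ ∉ C`, then
`n + 1 ≤ td(x̄, exp x̄ / C)`. Printed statement: "Suppose `C ⊆ F` is `ecl^F`-closed. Let
`x₁, …, xₙ ∈ F`. Then `td(x̄, exp(x̄)/C) - ldim_ℚ(x̄/C) ≥ dim^F(x̄/C)`", and `dim^F(x̄/C) ≥ 1` as
soon as some `xᵢ ∉ C = ecl C`. Proof as printed (Cor. 5.2 from Thm 5.1 = Ax): to the finite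
family of E-derivations over `C` witnessing linear independence modulo constants
(`exists_finite_eDer_family`) add one `∂ ∈ EDer(F/C)` with `∂ xᵢ ≠ 0` (it exists as
`xᵢ ∉ dcl C`); then the rank term in Ax's inequality `n + rk(∂ⱼ xᵢ) ≤ td` is `≥ 1`.
[cite: Kirby2010, Thm. 1.2] -/
theorem succ_le_relTrdeg_of_dcl_subset (hAx : Transcendental.ax_schanuel) {C : Set F}
    (hC : dcl C ⊆ C) {n : ℕ} {x : Fin n → F}
    (hx : LinearIndependent ℚ ((Submodule.span ℚ C).mkQ ∘ x)) {i₀ : Fin n} (hi₀ : x i₀ ∉ C) :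
    ((n + 1 : ℕ) : Cardinal) ≤ relTrdeg C x := by
  classical
  obtain ⟨m, D, hD, hind⟩ := exists_finite_eDer_family hC hx
  -- one more derivation, not killing `x i₀`
  have hi₀' : x i₀ ∉ dcl C := fun h => hi₀ (hC h)
  rw [mem_dcl_iff] at hi₀'
  push Not at hi₀'
  obtain ⟨D', hD', hD'x⟩ := hi₀'
  let D₁ : Fin (m + 1) → Derivation ℤ F F := Fin.snoc D D'
  have hD₁ : ∀ j, D₁ j ∈ eDer F C := by
    intro j
    refine Fin.lastCases ?_ (fun j => ?_) j
    · simpa [D₁] using hD'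
    · simpa [D₁] using hD j
  have hind₁ : Transcendental.IsQLinearIndependentMod D₁ x := by
    intro q hq
    refine hind q fun j => ?_
    have := hq (Fin.castSucc j)
    simpa [D₁] using this
  have h := hAx F (m + 1) n D₁ x (exp ∘ x)
    (fun i => (isUnit_exp (x i)).ne_zero) (fun j i => (hD₁ j).1 (x i)) hind₁
  -- the rank term is `≥ 1`
  have hrank : 1 ≤ (Matrix.of fun i j => D₁ j (x i)).rank := by
    set A := (Matrix.of fun i j => D₁ j (x i)) with hA
    let B : Matrix Unit Unit F := A.submatrix (fun _ => i₀) (fun _ => Fin.last m)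
    have hBdet : B.det = D' (x i₀) := by
      rw [Matrix.det_unique]
      simp [B, hA, D₁]
    have hB : B.rank = 1 := by
      rw [Matrix.rank_of_isUnit B ((Matrix.isUnit_iff_isUnit_det B).2
        (by rw [hBdet]; exact isUnit_iff_ne_zero.2 hD'x)), Fintype.card_unit]
    calc 1 = B.rank := hB.symm
      _ ≤ A.rank := Matrix.rank_submatrix_le A _ _
  have hn : ((n + 1 : ℕ) : Cardinal) ≤
      ((n + (Matrix.of fun i j => D₁ j (x i)).rank : ℕ) : Cardinal) := by
    exact_mod_cast Nat.add_le_add_left hrank n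
  refine hn.trans (h.trans ?_)
  -- move the base of the transcendence degree from the constants down to `ℚ(C)`
  let E : IntermediateField ℚ F :=
    ({ Transcendental.constantSubring D₁ with
        inv_mem' := fun _ ha => Transcendental.inv_mem_constantSubring ha } : Subfield F)
      |>.toIntermediateField fun q j => by
        rw [Algebra.algebraMap_eq_smul_one, Rat.smul_one_eq_cast]
        exact derivation_map_ratCast (D₁ j) q
  have hE : (E : Set F) = Transcendental.constantSubring D₁ := rfl
  have hCsub : C ⊆ (E : Set F) := fun c hc =>
    show c ∈ Transcendental.constantSubring D₁ from fun j => (hD₁ j).2 c hc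
  have hLE : ((IntermediateField.adjoin ℚ C : IntermediateField ℚ F) : Set F) ⊆
      Transcendental.constantSubring D₁ := by
    rw [← hE]
    exact IntermediateField.adjoin_le_iff.mpr hCsub
  exact trdeg_adjoin_le_of_subset (Transcendental.constantSubring D₁) (IntermediateField.adjoin ℚ C)
    hLE (Set.range x ∪ Set.range (exp ∘ x))

end KirbyDim

end GammaField

/-! ### Kirby 2010, Thm 1.2 with the dimension term `≥ 1`, from Ax's theorem alone -/

section KirbySharp

open MvPolynomial

-- one long elementary argument (that of `le_relTrdeg_of_isEclClosed`, keeping Ax's rank term);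
-- splitting it into lemmas would mean threading a dozen `set` abbreviations through their statements
set_option maxHeartbeats 400000 in
/-- **Kirby 2010, Thm. 1.2 with the dimension term `≥ 1`, from Ax's theorem alone.** If
`C ⊆ K` is `ecl`-closed, `n ≥ 1` and `x : Fin n → K` is `ℚ`-linearly independent modulo `⟨C⟩_ℚ`,
then `n + 1 ≤ td(x̄, exp x̄ / C)`. Printed statement: "Suppose `C ⊆ F` is `ecl^F`-closed. Let
`x₁, …, xₙ ∈ F`. Then `td(x̄, exp(x̄)/C) - ldim_ℚ(x̄/C) ≥ dim^F(x̄/C)`", and `dim^F(x̄/C) ≥ 1`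
because `x₁ ∉ C = ecl C`. Proof: the argument of `le_relTrdeg_of_isEclClosed` (Kirby's proof of
Thm. 1.2 / Prop. 7.1 run inside `L = ℚ(C)(x̄, e^{x̄})` via the Khovanskii dichotomy), keeping the
rank term of Ax's theorem: a Khovanskii system would put `x₁ ∈ ecl C = C`; otherwise there is a
non-zero E-derivation `∂` of `L` over `C` with constants `E`, `n = m + n'` with `m < n`,
`m ≤ trdeg_C E` (`le_relTrdeg_of_isEclClosed` for an integral basis `z̄` of `{q | q·x̄ ∈ E}`),
and Ax's theorem for `(L, ∂)` and a maximal sub-tuple `x̄'` of `x̄` independent modulo `E` gives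
`n' + rk(∂x̄') ≤ trdeg_E L` with `rk(∂x̄') = 1` (`∂x'ᵢ ≠ 0` as `x'ᵢ ∉ E`, and `n' ≥ 1`); the tower
law concludes. Fields in `Type` (the universe of `ax_schanuel`).
[cite: Kirby2010, Thm. 1.2 and Cor. 5.2] -/
theorem succ_le_relTrdeg_of_isEclClosed {K : Type} [Field K] [CharZero K] [Literature.ModelTheory.ExponentialFields.ExponentialRing K]
    (hAx : Transcendental.ax_schanuel) {C : Set K} (hC : IsEclClosed C) {n : ℕ} (hn : 0 < n)
    {x : Fin n → K} (hx : LinearIndependent ℚ ((Submodule.span ℚ C).mkQ ∘ x)) :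
    ((n + 1 : ℕ) : Cardinal) ≤ relTrdeg C x := by
  classical
  -- the base field `F = ℚ(C)` (`= C`) and the field `L = F(x̄, e^{x̄})`
  set F : IntermediateField ℚ K := IntermediateField.adjoin ℚ C with hF
  have hFC : ∀ c : F, (c : K) ∈ C := fun c => adjoin_rat_le_of_isEclClosed hC c.2
  set S : Set K := Set.range x ∪ Set.range (Literature.ModelTheory.ExponentialFields.ExponentialRing.exp ∘ x) with hS
  set L : IntermediateField F K := IntermediateField.adjoin F S with hL
  change ((n + 1 : ℕ) : Cardinal) ≤ Algebra.trdeg F L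
  have hxS : ∀ i, x i ∈ L := fun i => IntermediateField.subset_adjoin F S (Or.inl ⟨i, rfl⟩)
  have hyS : ∀ i, Literature.ModelTheory.ExponentialFields.ExponentialRing.exp (x i) ∈ L := fun i =>
    IntermediateField.subset_adjoin F S (Or.inr ⟨i, rfl⟩)
  set xL : Fin n → L := fun i => ⟨x i, hxS i⟩ with hxL
  set yL : Fin n → L := fun i => ⟨Literature.ModelTheory.ExponentialFields.ExponentialRing.exp (x i), hyS i⟩ with hyL
  have hy0 : ∀ i, yL i ≠ 0 := fun i h =>
    (Literature.ModelTheory.ExponentialFields.ExponentialRing.isUnit_exp (x i)).ne_zero (congrArg Subtype.val h)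
  have htopL : IntermediateField.adjoin F (Set.range xL ∪ Set.range yL) = ⊤ := by
    have h := IntermediateField.adjoin_preimage_val_eq_top (F := F) S
    have hpre : Set.range xL ∪ Set.range yL = ((↑) : L → K) ⁻¹' S := by
      ext t
      simp only [Set.mem_union, Set.mem_range, Set.mem_preimage, hS, Function.comp_apply]
      constructor
      · rintro (⟨i, rfl⟩ | ⟨i, rfl⟩)
        · exact Or.inl ⟨i, rfl⟩
        · exact Or.inr ⟨i, rfl⟩
      · rintro (⟨i, hi⟩ | ⟨i, hi⟩)
        · exact Or.inl ⟨i, Subtype.ext hi⟩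
        · exact Or.inr ⟨i, Subtype.ext hi⟩
    rw [hpre]
    exact h
  set zL : Fin n ⊕ Fin n → L := Sum.elim xL yL with hzL
  rcases khovanskii_dichotomy xL yL htopL with ⟨g, hg0, hdet⟩ | ⟨D, hDE, j₀, hj₀⟩
  · /- (a) `x̄` solves a Khovanskii system over `C`: impossible -/
    exfalso
    simp only [← hzL] at hg0 hdet
    have hkpt : Khovanskii.kpt x = algebraMap L K ∘ zL := by
      funext s; rcases s with i | i <;> rfl
    have heval : ∀ p : MvPolynomial (Fin n ⊕ Fin n) F,
        MvPolynomial.eval (Khovanskii.kpt x) (MvPolynomial.map (algebraMap F K) p) =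
          algebraMap L K (aeval zL p) := by
      intro p
      rw [MvPolynomial.eval_map, ← MvPolynomial.aeval_def, hkpt, MvPolynomial.aeval_algebraMap_apply]
    set f : Fin n → MvPolynomial (Fin n ⊕ Fin n) K := fun i => MvPolynomial.map (algebraMap F K) (g i)
      with hf
    have hsol : Khovanskii.IsSol C x f :=
      { coeff := fun i => Khovanskii.mem_polyOver_iff.mpr fun mo => by
          simp only [hf, MvPolynomial.coeff_map]
          exact Subring.subset_closure (hFC _)
        eval_eq := fun i => by
          simp only [hf]
          rw [heval, hg0 i, map_zero]
        det_ne := by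
          have hJ : Khovanskii.kjac x f =
              (algebraMap L K).mapMatrix (Matrix.of fun i j => aeval zL (Khovanskii.ePD j (g i))) := by
            ext i j
            simp only [Khovanskii.kjac, Matrix.of_apply, RingHom.mapMatrix_apply, Matrix.map_apply, hf]
            rw [Khovanskii.ePD_map, heval]
          rw [hJ, ← RingHom.map_det, map_ne_zero]
          exact hdet }
    have hmem : x ⟨0, hn⟩ ∈ ecl C :=
      Khovanskii.mem_ecl_iff.mpr ⟨Fin n, inferInstance, inferInstance, x, f, hsol, ⟨0, hn⟩, rfl⟩
    have hC' : ecl C = C := hC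
    rw [hC'] at hmem
    have h0 : ((Submodule.span ℚ C).mkQ ∘ x) ⟨0, hn⟩ = 0 := by
      simp only [Function.comp_apply, Submodule.mkQ_apply, Submodule.Quotient.mk_eq_zero]
      exact Submodule.subset_span hmem
    exact hx.ne_zero ⟨0, hn⟩ h0
  · /- (b) a non-zero E-derivation `D` of `L` over `F` -/
    -- `D` as a `ℤ`-derivation, its constants `CD`
    set Dz : Derivation ℤ L L := D.restrictScalars ℤ with hDz
    set D1 : Fin 1 → Derivation ℤ L L := fun _ => Dz with hD1
    set CD : Subring L := Transcendental.constantSubring D1 with hCD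
    have hmemCD : ∀ a : L, a ∈ CD ↔ D a = 0 := fun a => by
      simp only [hCD, hD1, hDz, Transcendental.mem_constantSubring, forall_const]
      exact Iff.rfl
    have hFCD : ∀ c : F, algebraMap F L c ∈ CD := fun c => (hmemCD _).mpr (D.map_algebraMap c)
    -- the elements of `L` killed by `D`, as a `ℚ`-subspace `N` of `K`
    set N : Submodule ℚ K := Submodule.restrictScalars ℚ
      ((LinearMap.ker (D : L →ₗ[F] L)).map (IsScalarTower.toAlgHom F L K).toLinearMap) with hN
    have hmemN : ∀ a : K, a ∈ N ↔ ∃ l : L, D l = 0 ∧ (l : K) = a := fun a => by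
      simp only [hN, Submodule.restrictScalars_mem, Submodule.mem_map, LinearMap.mem_ker]
      constructor
      · rintro ⟨l, hl, rfl⟩; exact ⟨l, hl, rfl⟩
      · rintro ⟨l, hl, rfl⟩; exact ⟨l, hl, rfl⟩
    -- the dependence space `V = {q ∈ ℚⁿ | q·x̄ ∈ N}` and the splitting `n = n' + m`
    set T : (Fin n → ℚ) →ₗ[ℚ] K := Fintype.linearCombination ℚ x with hT
    have hTapply : ∀ v : Fin n → ℚ, T v = ∑ i, v i • x i := fun v =>
      Fintype.linearCombination_apply ℚ x v
    set V : Submodule ℚ (Fin n → ℚ) := N.comap T with hV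
    set T' : (Fin n → ℚ) →ₗ[ℚ] K ⧸ N := N.mkQ ∘ₗ T with hT'
    have hker : LinearMap.ker T' = V := by rw [hT', LinearMap.ker_comp, Submodule.ker_mkQ]
    obtain ⟨κ, a, ha, hspan, hli⟩ := exists_linearIndependent' ℚ ((Submodule.mkQ N) ∘ x)
    haveI : Fintype κ := Fintype.ofInjective a ha
    set n' := Fintype.card κ with hn'
    set e := Fintype.equivFin κ with he
    have hrange : Module.finrank ℚ (LinearMap.range T') = n' := by
      have h1 : LinearMap.range T' = Submodule.span ℚ (Set.range (N.mkQ ∘ x)) := by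
        rw [hT', LinearMap.range_comp, hT, Fintype.range_linearCombination, Submodule.map_span,
          ← Set.range_comp]
      rw [h1, ← hspan, finrank_span_eq_card hli]
    set m := Module.finrank ℚ V with hm
    have hnm : n' + m = n := by
      have := LinearMap.finrank_range_add_finrank_ker T'
      rwa [hrange, hker, Module.finrank_fin_fun] at this
    have hmn : m < n := by
      by_contra hmn'
      have hmn2 : m = n := le_antisymm (by omega) (not_lt.mp hmn')
      have hVtop : V = ⊤ :=
        Submodule.eq_top_of_finrank_eq (by rw [← hm, hmn2, Module.finrank_fin_fun])
      have hmemV : (Pi.single j₀ (1 : ℚ) : Fin n → ℚ) ∈ V := hVtop ▸ Submodule.mem_top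
      rw [hV, Submodule.mem_comap, hT, Fintype.linearCombination_apply_single, one_smul] at hmemV
      obtain ⟨l, hl0, hl⟩ := (hmemN _).mp hmemV
      have hlx : l = xL j₀ := Subtype.ext hl
      rw [hlx] at hl0
      exact hj₀ hl0
    have hn'pos : 0 < n' := by omega
    -- Ax's theorem (with its rank term) for a maximal sub-tuple `x̄'` of `x̄` independent modulo `N`
    set x' : Fin n' → L := fun i => xL (a (e.symm i)) with hx'
    set y' : Fin n' → L := fun i => yL (a (e.symm i)) with hy'
    have hind : Transcendental.IsQLinearIndependentMod D1 x' := by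
      intro q hq
      have hD0 : D (∑ i, (q i : L) * x' i) = 0 := (hmemCD _).mp hq
      have hNmem : (∑ i, ((q i : ℚ)) • x (a (e.symm i))) ∈ N := by
        refine (hmemN _).mpr ⟨_, hD0, ?_⟩
        rw [show (∑ i, ((q i : ℚ)) • x (a (e.symm i))) = ∑ i, (q i : K) * x (a (e.symm i)) from
          Finset.sum_congr rfl fun i _ => by rw [Rat.smul_def, Rat.cast_intCast]]
        push_cast
        simp only [hx', hxL]
      have h0 : ∑ i, ((q i : ℤ) : ℚ) • ((N.mkQ ∘ x ∘ a) ∘ e.symm) i = 0 := by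
        have h1 : N.mkQ (∑ i, ((q i : ℚ)) • x (a (e.symm i))) = 0 :=
          (Submodule.Quotient.mk_eq_zero N).mpr hNmem
        rw [map_sum] at h1
        simpa only [map_smul, Function.comp_apply] using h1
      have hli' : LinearIndependent ℚ ((N.mkQ ∘ x ∘ a) ∘ e.symm) := hli.comp e.symm e.symm.injective
      have h2 := Fintype.linearIndependent_iff.mp hli' _ h0
      funext i
      exact_mod_cast h2 i
    have hAxL' := hAx L 1 n' D1 x' y' (fun i => hy0 _) (fun _ i => hDE (a (e.symm i))) hind
    -- the rank term is `≥ 1`: `D x'₀ ≠ 0` since `x'₀ ∉ N`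
    have hDx' : ∀ i, D (x' i) ≠ 0 := by
      intro i hDi
      have hmem : x (a (e.symm i)) ∈ N := (hmemN _).mpr ⟨x' i, hDi, rfl⟩
      have hli' : LinearIndependent ℚ ((N.mkQ ∘ x ∘ a) ∘ e.symm) := hli.comp e.symm e.symm.injective
      apply hli'.ne_zero i
      simp only [Function.comp_apply, Submodule.mkQ_apply, Submodule.Quotient.mk_eq_zero]
      exact hmem
    have hrank : 1 ≤ (Matrix.of fun i j => D1 j (x' i)).rank := by
      set A := (Matrix.of fun i j => D1 j (x' i)) with hA
      let i₀ : Fin n' := ⟨0, hn'pos⟩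
      let B : Matrix Unit Unit L := A.submatrix (fun _ => i₀) (fun _ => (0 : Fin 1))
      have hBdet : B.det = D (x' i₀) := by
        rw [Matrix.det_unique]
        simp [B, hA, hD1, hDz]
      have hB : B.rank = 1 := by
        rw [Matrix.rank_of_isUnit B ((Matrix.isUnit_iff_isUnit_det B).2
          (by rw [hBdet]; exact isUnit_iff_ne_zero.2 (hDx' i₀))), Fintype.card_unit]
      calc 1 = B.rank := hB.symm
        _ ≤ A.rank := Matrix.rank_submatrix_le A _ _
    have hAxL := le_trans (Nat.cast_le.mpr (Nat.add_le_add_left hrank n')) hAxL'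
    letI algCD : Algebra CD L := Algebra.ofSubsemiring CD
    have h1 : ((n' + 1 : ℕ) : Cardinal) ≤ Algebra.trdeg CD L :=
      hAxL.trans (trdeg_le_of_injective (Subalgebra.val _) Subtype.val_injective)
    -- an integral basis of `V` and the tuple `z̄`
    let bV := Module.finBasis ℚ V
    have hint : ∀ k : Fin m, ∃ d : ℕ, d ≠ 0 ∧ ∃ w : Fin n → ℤ,
        ∀ i, (d : ℚ) * ((bV k : V) : Fin n → ℚ) i = w i := fun k => exists_nat_mul_eq_intCast _
    choose d hd w hw using hint
    have huV : ∀ k, (fun i => (w k i : ℚ)) ∈ V := fun k => by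
      have : (fun i => (w k i : ℚ)) = (d k : ℚ) • ((bV k : V) : Fin n → ℚ) := by
        funext i; rw [Pi.smul_apply, smul_eq_mul, hw]
      rw [this]
      exact V.smul_mem _ (bV k).2
    have hli_u : LinearIndependent ℚ (fun k => fun i => (w k i : ℚ)) := by
      have hb : LinearIndependent ℚ (fun k => ((bV k : V) : Fin n → ℚ)) :=
        bV.linearIndependent.map' V.subtype (Submodule.ker_subtype V)
      have hb2 := hb.units_smul fun k => Units.mk0 (d k : ℚ) (Nat.cast_ne_zero.mpr (hd k))
      convert hb2 using 1
      funext k i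
      change (w k i : ℚ) = ((Units.mk0 (d k : ℚ) (Nat.cast_ne_zero.mpr (hd k))) •
        ((bV k : V) : Fin n → ℚ)) i
      rw [Units.smul_def, Units.val_mk0, Pi.smul_apply, smul_eq_mul, hw]
    set z : Fin m → K := fun k => ∑ i, (w k i : K) * x i with hz
    -- `z̄` is independent modulo `C`
    have hzind : LinearIndependent ℚ ((Submodule.span ℚ C).mkQ ∘ z) := by
      rw [Fintype.linearIndependent_iff]
      intro c hc
      have hc1 : ∑ i, (∑ k, c k * (w k i : ℚ)) • ((Submodule.span ℚ C).mkQ ∘ x) i = 0 := by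
        rw [← hc]
        simp only [Function.comp_apply, hz, map_sum, Finset.smul_sum, Finset.sum_smul, mul_smul]
        rw [Finset.sum_comm]
        refine Finset.sum_congr rfl fun k _ => Finset.sum_congr rfl fun i _ => ?_
        rw [← map_smul, ← map_smul, ← map_smul, Rat.smul_def (w k i : ℚ), Rat.cast_intCast]
      have hc2 := Fintype.linearIndependent_iff.mp hx _ hc1
      have hc3 : ∑ k, c k • (fun i => (w k i : ℚ)) = 0 := by
        funext i
        rw [Finset.sum_apply, Pi.zero_apply]
        simpa only [Pi.smul_apply, smul_eq_mul] using hc2 i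
      exact Fintype.linearIndependent_iff.mp hli_u c hc3
    -- `z_k ∈ L` and `e^{z_k} ∈ L` are killed by `D`
    set zLk : Fin m → L := fun k => ∑ i, (w k i : L) * xL i with hzLk
    have hzcoe : ∀ k, ((zLk k : L) : K) = z k := fun k => by
      simp only [hzLk, hz, hxL]
      push_cast
      rfl
    have hDz0 : ∀ k, D (zLk k) = 0 := fun k => by
      obtain ⟨l, hl0, hl⟩ := (hmemN _).mp (Submodule.mem_comap.mp (huV k))
      have hTz : T (fun i => (w k i : ℚ)) = z k := by
        rw [hTapply, hz]
        exact Finset.sum_congr rfl fun i _ => by rw [Rat.smul_def, Rat.cast_intCast]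
      have hl' : l = zLk k := Subtype.ext (by rw [hl, hTz, hzcoe])
      rw [← hl']
      exact hl0
    set ezLk : Fin m → L := fun k => ∏ i, yL i ^ w k i with hezLk
    have hezcoe : ∀ k, ((ezLk k : L) : K) = Literature.ModelTheory.ExponentialFields.ExponentialRing.exp (z k) := fun k => by
      rw [hz]
      dsimp only
      rw [exp_sum_intCast_mul]
      simp only [hezLk, hyL]
      push_cast
      rfl
    have hDez0 : ∀ k, D (ezLk k) = 0 := fun k => by
      simp only [hezLk]
      rw [derivation_prod_zpow_of_exp D xL yL hy0 hDE (w k)]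
      have : D (∑ i, (w k i : L) * xL i) = 0 := hDz0 k
      rw [this, mul_zero]
    -- the weak form (`δ ≥ 0`) for `z̄`
    have hIH : (m : Cardinal) ≤ relTrdeg C z := le_relTrdeg_of_isEclClosed hAx hC m z hzind
    set Sz : Set K := Set.range z ∪ Set.range (Literature.ModelTheory.ExponentialFields.ExponentialRing.exp ∘ z) with hSz
    set Nz : IntermediateField F K := IntermediateField.adjoin F Sz with hNz
    change (m : Cardinal) ≤ Algebra.trdeg F Nz at hIH
    have hle : Nz ≤ L := by
      rw [hNz, IntermediateField.adjoin_le_iff]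
      rintro t (⟨k, rfl⟩ | ⟨k, rfl⟩)
      · rw [← hzcoe]; exact (zLk k).2
      · simp only [Function.comp_apply]; rw [← hezcoe]; exact (ezLk k).2
    have hιE : ∀ (t : K) (ht : t ∈ Nz), (⟨t, hle ht⟩ : L) ∈ CD := by
      intro t ht
      rw [hmemCD]
      induction ht using IntermediateField.adjoin_induction with
      | mem t ht =>
        rcases ht with ⟨k, rfl⟩ | ⟨k, rfl⟩
        · have h' : (⟨z k, hle (IntermediateField.subset_adjoin F Sz (Or.inl ⟨k, rfl⟩))⟩ : L) =
              zLk k := Subtype.ext (hzcoe k).symm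
          rw [h']; exact hDz0 k
        · have h' : (⟨(Literature.ModelTheory.ExponentialFields.ExponentialRing.exp ∘ z) k,
              hle (IntermediateField.subset_adjoin F Sz (Or.inr ⟨k, rfl⟩))⟩ : L) = ezLk k :=
            Subtype.ext (hezcoe k).symm
          rw [h']; exact hDez0 k
      | algebraMap c => exact D.map_algebraMap c
      | add s t hs ht ihs iht =>
        have h' : (⟨s + t, hle (add_mem hs ht)⟩ : L) = ⟨s, hle hs⟩ + ⟨t, hle ht⟩ := rfl
        rw [h', map_add, ihs, iht, add_zero]
      | inv s hs ihs =>
        have h' : (⟨s⁻¹, hle (inv_mem hs)⟩ : L) = (⟨s, hle hs⟩)⁻¹ := rfl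
        rw [h', Derivation.leibniz_inv, ihs, smul_zero]
      | mul s t hs ht ihs iht =>
        have h' : (⟨s * t, hle (mul_mem hs ht)⟩ : L) = ⟨s, hle hs⟩ * ⟨t, hle ht⟩ := rfl
        rw [h', Derivation.leibniz, ihs, iht, smul_zero, smul_zero, add_zero]
    -- assembling: `n + 1 = m + (n' + 1) ≤ trdeg_F Nz + trdeg_CD L ≤ trdeg_F L`
    have htower := trdeg_add_le_of_le_subring L Nz hle CD hFCD hιE
    calc ((n + 1 : ℕ) : Cardinal) = (m : Cardinal) + ((n' + 1 : ℕ) : Cardinal) := by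
          rw [← hnm]; push_cast; ring
      _ ≤ Algebra.trdeg F Nz + Algebra.trdeg CD L := add_le_add hIH h1
      _ ≤ Algebra.trdeg F L := htower

end KirbySharp

namespace GammaField

open Literature.ModelTheory.ExponentialFields.ExponentialRing

section EclGammaClosed

variable {F : Type} [Field F] [CharZero F] [Literature.ModelTheory.ExponentialFields.ExponentialRing F]

/-! ### `ecl`-closed sets are Γ-closed -/

/-- **`ecl`-closed sets are Γ-closed** (Bays–Kirby 2018, Remark 10.10, "`ecl`-closed =
`Γcl`-closed [EAEF]", in the direction used in §11: for `H = ecl H` and a proper finitely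
generated extension `H + ℚx̄`, `δ(x̄/H) ≥ 1`), from Ax's theorem alone via Kirby 2010 Thm 1.2
with `dim^F(x̄/H) ≥ 1` (`Literature.NumberTheory.Transcendental.succ_le_relTrdeg_of_isEclClosed`).
[cite: BaysKirby2018ANT, Remark 10.10] [cite: Kirby2010, Thm. 1.2] -/
theorem isGammaClosed_span_ecl (hAx : Transcendental.ax_schanuel) (C : Set F) :
    IsGammaClosed (Submodule.span ℚ (ecl C)) := by
  classical
  set Λ := Submodule.span ℚ (ecl C) with hΛ
  intro Λ' hle hfg hδ
  by_contra hne
  haveI := hfg.finite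
  -- a `ℚ`-basis of `Λ'` modulo `Λ`, lifted to `Λ'`
  set n := ldim Λ Λ' with hn
  have hn0 : n ≠ 0 := by
    rw [hn, Ne, ldim_eq_zero_iff hfg]
    exact fun h => hne (le_antisymm h hle)
  let b := Module.finBasis ℚ ↥(Λ'.map Λ.mkQ)
  have hcard : Module.finrank ℚ ↥(Λ'.map Λ.mkQ) = n := rfl
  have hmem : ∀ i : Fin n, ∃ y ∈ Λ', Λ.mkQ y = (b (Fin.cast hcard.symm i) : F ⧸ Λ) := fun i =>
    Submodule.mem_map.1 (b (Fin.cast hcard.symm i)).2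
  choose x hxΛ' hxb using hmem
  -- `x` is linearly independent modulo `Λ = span (ecl C)`
  have hx : LinearIndependent ℚ ((Submodule.span ℚ (ecl C)).mkQ ∘ x) := by
    have hb : LinearIndependent ℚ
        (fun i : Fin n => ((b (Fin.cast hcard.symm i) : ↥(Λ'.map Λ.mkQ)) : F ⧸ Λ)) :=
      (b.linearIndependent.map' (Λ'.map Λ.mkQ).subtype (Submodule.ker_subtype _)).comp _
        (Fin.cast_injective _)
    convert hb using 1
    funext i
    exact hxb i
  -- Kirby's inequality (`n ≥ 1`) and the bridge to `td`
  have hK := succ_le_relTrdeg_of_isEclClosed hAx (isEclClosed_ecl C) (Nat.pos_of_ne_zero hn0) hx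
  have h1 : ((n + 1 : ℕ) : ℕ∞) ≤ (algMatroid F).relRank (ecl C) (range x ∪ range (exp ∘ x)) := by
    have := (OrderHomClass.mono Cardinal.toENat hK).trans (toENat_relTrdeg_le_relRank (ecl C) x)
    rwa [map_natCast] at this
  have h2 : (algMatroid F).relRank (ecl C) (range x ∪ range (exp ∘ x)) ≤ td Λ Λ' := by
    rw [← td_span_ecl_span_eq]
    calc td Λ (Submodule.span ℚ (range x)) = td Λ (Λ ⊔ Submodule.span ℚ (range x)) :=
          (td_sup_left _ _).symm
      _ ≤ td Λ Λ' := td_mono Λ (sup_le hle (Submodule.span_le.2 (range_subset_iff.2 hxΛ')))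
  have h3 : n + 1 ≤ (td Λ Λ').toNat := by
    have hne' : td Λ Λ' ≠ ⊤ := td_ne_top hfg
    have := h1.trans h2
    rw [← ENat.coe_toNat hne'] at this
    exact_mod_cast this
  have h4 : predim Λ Λ' = ((td Λ Λ').toNat : ℤ) - (n : ℤ) := rfl
  omega

/-- `ecl`-closed sets are strong: `δ(x̄/ecl C) ≥ 0` (Kirby 2010 Thm 1.2 in the form `≥ 0`;
Bays–Kirby 2018 Lemma 4.10 (1)). [cite: Kirby2010, Thm. 1.2] -/
theorem isStrong_span_ecl (hAx : Transcendental.ax_schanuel) (C : Set F) :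
    IsStrong (Submodule.span ℚ (ecl C)) :=
  (isGammaClosed_span_ecl hAx C).isStrong

end EclGammaClosed

/-! ### Monotonicity of `span ℚ (ecl ·)` -/

section Mono

variable {F : Type*} [Field F] [CharZero F] [Literature.ModelTheory.ExponentialFields.ExponentialRing F]

/-- `span ℚ (ecl ·)` is monotone. [cite: Kirby2010, Lemma 3.3] -/
theorem span_ecl_mono {C C' : Set F} (h : C ⊆ C') :
    Submodule.span ℚ (ecl C) ≤ Submodule.span ℚ (ecl C') :=
  Submodule.span_mono (ecl_mono h)

/-- `C ⊆ Submodule.span ℚ (ecl C)`. [cite: Kirby2010, Lemma 3.3] -/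
theorem subset_span_ecl (C : Set F) : C ⊆ Submodule.span ℚ (ecl C) :=
  (subset_ecl C).trans Submodule.subset_span

/-- `span C ≤ Submodule.span ℚ (ecl C)`. [cite: Kirby2010, Lemma 3.3] -/
theorem span_le_span_ecl (C : Set F) : Submodule.span ℚ C ≤ Submodule.span ℚ (ecl C) :=
  Submodule.span_mono (subset_ecl C)

/-- `span (ecl (ecl C)) = span (ecl C)`. [cite: Kirby2010, Lemma 3.3] -/
@[simp] theorem span_ecl_ecl (C : Set F) :
    Submodule.span ℚ (ecl (ecl C)) = Submodule.span ℚ (ecl C) := by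
  rw [Khovanskii.ecl_ecl C]

/-- `ecl C` is countable when `C` is, under the countable closure property. [folklore] -/
theorem countable_span_ecl (hccp : HasCountableClosureProperty F) {C : Set F}
    (hC : C.Countable) : ((Submodule.span ℚ (ecl C) : Submodule ℚ F) : Set F).Countable := by
  rw [coe_span_ecl]; exact hccp C hC

end Mono

/-! ### The bridging equalities `td = relTrdeg` (review request on `GammaFields.lean`) -/

section BridgeEq

open Matroid

variable {F : Type*} [Field F] [CharZero F] [Literature.ModelTheory.ExponentialFields.ExponentialRing F]

omit [Literature.ModelTheory.ExponentialFields.ExponentialRing F] in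
/-- **Relative rank versus `Algebra.trdeg`, the other inequality.** For a subfield `L ≤ F` and
`S ⊆ F`, the relative rank of `S` over `L` in the algebraic matroid of `F/ℚ` is at most the
transcendence degree of `L(S)/L`: a basis `I ⊆ S ∖ L` of `S` over `L` in the matroid is, together
with a transcendence basis `B` of `L/ℚ`, algebraically independent over `ℚ`, hence `I` is
algebraically independent over `ℚ(B)` and so over its algebraic extension `L`
(`AlgebraicIndependent.extendScalars`). [folklore] -/
theorem relRank_le_toENat_trdeg_adjoin (L : IntermediateField ℚ F) (S : Set F) :
    (algMatroid F).relRank (L : Set F) S ≤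
      toENat (Algebra.trdeg L (IntermediateField.adjoin L S)) := by
  classical
  set M := algMatroid F
  obtain ⟨I, hI⟩ := (M ／ (L : Set F)).exists_isBasis (S \ (L : Set F))
    (by rw [contract_ground]; exact fun a ha => ⟨mem_univ a, ha.2⟩)
  rw [relRank_eq_relRank_diff, relRank_eq_eRk_contract, ← hI.encard_eq_eRk]
  obtain ⟨B, hB⟩ := M.exists_isBasis (L : Set F) (subset_univ _)
  obtain ⟨hIB, hLI⟩ := hB.contract_indep_iff.1 hI.indep
  have hBL : B ⊆ (L : Set F) := hB.subset
  have hdisj : Disjoint I B := Disjoint.mono_right hBL hLI.symm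
  -- `I ∪ B` algebraically independent over `ℚ`, so `I` is independent over `ℚ[B]`
  have hinj : Function.Injective (Sum.elim ((↑) : I → F) ((↑) : B → F)) := by
    rintro (a | a) (b | b) h
    · exact congrArg Sum.inl (Subtype.ext h)
    · exact (Set.disjoint_left.1 hdisj a.2 ((show (a : F) = b from h) ▸ b.2)).elim
    · exact (Set.disjoint_left.1 hdisj b.2 ((show (a : F) = b from h) ▸ a.2)).elim
    · exact congrArg Sum.inr (Subtype.ext h)
  have hsum : AlgebraicIndependent ℚ (Sum.elim ((↑) : I → F) ((↑) : B → F)) := by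
    have hind : AlgebraicIndepOn ℚ id (I ∪ B) := AlgebraicIndependent.matroid_indep_iff.1 hIB
    refine (algebraicIndependent_subtype_range hinj).1 ?_
    rw [Sum.elim_range, Subtype.range_coe, Subtype.range_coe]
    exact hind
  set R := Algebra.adjoin ℚ (range ((↑) : B → F)) with hR
  have hI' : AlgebraicIndependent R ((↑) : I → F) := (AlgebraicIndependent.sumElim_iff.1 hsum).2
  -- extend scalars to `L`, which is algebraic over `ℚ[B]`
  have hRL : R ≤ L.toSubalgebra := by
    rw [hR, Subtype.range_coe]; exact Algebra.adjoin_le hBL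
  letI : Algebra R L := (Subalgebra.inclusion hRL).toRingHom.toAlgebra
  haveI : IsScalarTower R L F := IsScalarTower.of_algebraMap_eq fun _ => rfl
  haveI : Algebra.IsAlgebraic R L := by
    refine ⟨fun y => ?_⟩
    have hinj : Function.Injective (algebraMap L F) := (algebraMap L F).injective
    rw [← isAlgebraic_algebraMap_iff hinj]
    have hy : (y : F) ∈ acl B := by
      have : (L : Set F) ⊆ M.closure B := hB.subset_closure
      exact this y.2
    rw [mem_acl_iff] at hy
    rw [hR, Subtype.range_coe]
    exact hy
  have hIL : AlgebraicIndependent L ((↑) : I → F) := hI'.extendScalars L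
  -- push into `L(S)`
  set A : IntermediateField L F := IntermediateField.adjoin L S
  have hIS : (I : Set F) ⊆ (A : Set F) := fun a ha =>
    IntermediateField.subset_adjoin L S (hI.subset ha).1
  let x : I → A := fun a => ⟨a, hIS a.2⟩
  have hx : AlgebraicIndependent L x :=
    AlgebraicIndependent.of_comp A.val (by exact hIL)
  have h := hx.cardinalMk_le_trdeg
  calc I.encard = toENat #I := (toENat_cardinalMk I).symm
    _ ≤ toENat (Algebra.trdeg L A) := OrderHomClass.mono _ h

omit [Literature.ModelTheory.ExponentialFields.ExponentialRing F] in
/-- **`Algebra.trdeg` of `L(S)/L` is the relative rank of `S` over `L`** in the algebraic matroid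
of `F/ℚ` (in `ℕ∞`). [folklore] -/
theorem toENat_trdeg_adjoin_eq_relRank (L : IntermediateField ℚ F) (S : Set F) :
    toENat (Algebra.trdeg L (IntermediateField.adjoin L S)) =
      (algMatroid F).relRank (L : Set F) S :=
  le_antisymm (toENat_trdeg_adjoin_le_relRank L S) (relRank_le_toENat_trdeg_adjoin L S)

/-- **Kirby's `td(x̄, exp x̄/C)` is the relative rank of `x̄ ∪ exp x̄` over `C`** in the
algebraic matroid (the bridging equality requested in the review of `GammaFields.lean`).
[folklore] -/
theorem toENat_relTrdeg_eq_relRank {n : ℕ} (C : Set F) (x : Fin n → F) :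
    toENat (relTrdeg C x) =
      (algMatroid F).relRank C (range x ∪ range (Literature.ModelTheory.ExponentialFields.ExponentialRing.exp ∘ x)) := by
  rw [relTrdeg,
    (algMatroid F).relRank_congr_closure_left (range x ∪ range (Literature.ModelTheory.ExponentialFields.ExponentialRing.exp ∘ x))
    (show (algMatroid F).closure C =
      (algMatroid F).closure ((IntermediateField.adjoin ℚ C : IntermediateField ℚ F) : Set F)
      from (acl_adjoin C).symm)]
  exact toENat_trdeg_adjoin_eq_relRank _ _

/-- **`GammaField.td` versus `Literature.NumberTheory.Transcendental.relTrdeg`** for `Λ = span (ecl C)`: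
`td Λ (span x̄) = td(x̄, exp x̄ / ecl C)`. [folklore] -/
theorem td_span_ecl_span_eq_relTrdeg {n : ℕ} (C : Set F) (x : Fin n → F) :
    td (Submodule.span ℚ (ecl C)) (Submodule.span ℚ (range x)) = toENat (relTrdeg (ecl C) x) := by
  rw [td_span_ecl_span_eq, toENat_relTrdeg_eq_relRank]

end BridgeEq

end GammaField

end Literature.NumberTheory.Transcendental
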